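import Summits.RiemannHypothesis.RiemannHypothesis.Theorems.TiltedLandingLaw421R3Lens1ArcSignC

/-!
# TiltedLandingLaw421R3 — lens-1: RUNG 2 of the arc-sign ladder, part D — the partition loop inequality (multi-arc bookkeeping)

LENS-1 gen-6 module image `rh33346-cover/lens-1/ArcSignD-v1.lean` (landing target `…/Theorems/TiltedLandingLaw421R3Lens1ArcSignD.lean`; single import =
part C; namespace `RhW08.Lens1ArcSign`; 0 `sorry`, no instances / notation; checked BY CHAIN over the ArcSign A/B/C images until tree).

THE MULTI-ARC IDENTITY AS AN INEQUALITY (memo `O6b-MULTIARC-MEMO-v1.md` §2, NODE v14 P8-R2).  Along the upper half `[0, ½]` of a loop `Γ` (later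
`Γ = (f^{(j+1)}/f^{(j)}) ∘ circleLoop`), cut at the points where `Γ` is REAL, the POTENTIAL `Q(t) := Im l(t) − (π/2)·σ(t)` (`l` a continuous
logarithm, `σ = ±1` the sign of `Re Γ` at a real point) is CONSTANT across a good piece (`Im Γ ≤ 0`, rotate by `i`: `log_increment_eq`) and changes
by `π(σ_start − σ_end) ∈ {0, ±2π}` across a bad piece (`Im Γ ≥ 0`, rotate by `−i`) — negative exactly for an ASCENDING bad piece.  Hence, with no
ascending bad piece, `Im (l(½) − l(0)) ≥ (π/2)(σ(½) − σ(0))` (§3, by induction along the finitely many real points), and for a conjugation-symmetric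
loop `2·wind Γ = sgn Re Γ(½) − sgn Re Γ(0) + n`, `n ∈ ℕ` (§4) — the `m̃ = 0` lemma `two_mul_wind_eq` is the case of no bad piece.  §5 supplies the
finiteness of the real points for `Γ = (G′/G) ∘ circleLoop` (real-analytic in `t`; identity theorem: finitely many, or `Γ` real on the whole arc).

CONTENT: §1 `zsgn`, `sgn_eq_zsgn`, `im_log_I_mul`, `im_log_negI_mul` · §2 `im_incr_piece_down`, `im_incr_piece_up` · §3 `pos_or_neg_of_ne_zero`,
★ `im_incr_ge_of_noAsc` · §4 ★ `two_mul_wind_ge` · §5 `circleLoop_one_sub`, `analyticAt_im_logDeriv_circleLoop`, ★ `breaks_finite_or_flat`.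

HONEST LABEL: loop / analytic bookkeeping only; RUNG 2 (`PinningOfNoAscendingArc`) is proved in part E from these; `TopPinning`, 33346, 33347 OPEN;
nothing here bears on the truth of RH; RH is not proved; checked ≠ proved.
-/

noncomputable section

namespace RhW08.Lens1ArcSign

open Complex Set Metric Filter Topology
open scoped Real
open Literature.Topology.PlaneTopology Literature.Analysis.Complex
open Summit.RiemannHypothesis.RiemannHypothesis.Theorems.Splittings.JensenWindow

/-! ## §1 Integer signs and `Im log (±i x)` -/

/-- Integer sign: `1` for `r > 0`, `−1` otherwise (used at `r ≠ 0`); the tree's `sgn r` is its cast. -/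
def zsgn (r : ℝ) : ℤ := if 0 < r then 1 else -1

/-- `sgn = zsgn` in `ℂ`. -/
theorem sgn_eq_zsgn (r : ℝ) : sgn r = ((zsgn r : ℤ) : ℂ) := by
  unfold sgn zsgn
  split_ifs <;> simp

/-- `Im log (i x) = (π/2)·zsgn x` for real `x ≠ 0`. -/
theorem im_log_I_mul {r : ℝ} (hr : r ≠ 0) : (log (I * r)).im = π / 2 * (zsgn r : ℝ) := by
  unfold zsgn
  split_ifs with h
  · rw [show I * (r : ℂ) = (r : ℂ) * I by ring, Complex.log_im, Complex.arg_real_mul I h, Complex.arg_I]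
    push_cast; ring
  · have h' : 0 < -r := by
      rcases lt_or_gt_of_ne hr with h1 | h1
      · linarith
      · exact absurd h1 h
    rw [show I * (r : ℂ) = ((-r : ℝ) : ℂ) * (-I) by push_cast; ring, Complex.log_im, Complex.arg_real_mul (-I) h',
      Complex.arg_neg_I]
    push_cast; ring

/-- `Im log (−i x) = −(π/2)·zsgn x` for real `x ≠ 0`. -/
theorem im_log_negI_mul {r : ℝ} (hr : r ≠ 0) : (log (-I * r)).im = -(π / 2) * (zsgn r : ℝ) := by
  unfold zsgn
  split_ifs with h
  · rw [show -I * (r : ℂ) = (r : ℂ) * (-I) by ring, Complex.log_im, Complex.arg_real_mul (-I) h, Complex.arg_neg_I]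
    push_cast; ring
  · have h' : 0 < -r := by
      rcases lt_or_gt_of_ne hr with h1 | h1
      · linarith
      · exact absurd h1 h
    rw [show -I * (r : ℂ) = ((-r : ℝ) : ℂ) * I by push_cast; ring, Complex.log_im, Complex.arg_real_mul I h', Complex.arg_I]
    push_cast; ring

/-! ## §2 The two kinds of piece -/

/-- GOOD PIECE: `Im Γ ≤ 0` on `[u, v]`, real non-zero ends ⇒ every continuous logarithm gains `(π/2)(σ(v) − σ(u))` in imaginary part. -/
theorem im_incr_piece_down {Γ l : ℝ → ℂ} {u v : ℝ} (huv : u ≤ v) (hΓ : ContinuousOn Γ (Icc u v)) (hl : ContinuousOn l (Icc u v))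
    (hexp : ∀ t ∈ Icc u v, exp (l t) = Γ t) (hne : ∀ t ∈ Icc u v, Γ t ≠ 0) (hdown : ∀ t ∈ Icc u v, (Γ t).im ≤ 0)
    (hu : (Γ u).im = 0) (hv : (Γ v).im = 0) :
    (l v).im - (l u).im = π / 2 * ((zsgn (Γ v).re : ℝ) - (zsgn (Γ u).re : ℝ)) := by
  have hcut : ∀ t ∈ Icc u v, I * Γ t ∈ slitPlane := by
    intro t ht
    rw [mem_slitPlane_iff]
    rcases (hdown t ht).lt_or_eq with hlt | heq
    · left
      have e : (I * Γ t).re = -(Γ t).im := by simp [Complex.mul_re]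
      rw [e]; linarith
    · right
      have hre : (Γ t).re ≠ 0 := fun h => hne t ht (Complex.ext (by simpa using h) (by simpa using heq))
      simpa [Complex.mul_im] using hre
  have e := log_increment_eq huv hΓ hl hexp I_ne_zero hcut
  have hreU : (Γ u).re ≠ 0 := fun h => hne u (left_mem_Icc.2 huv) (Complex.ext (by simpa using h) (by simpa using hu))
  have hreV : (Γ v).re ≠ 0 := fun h => hne v (right_mem_Icc.2 huv) (Complex.ext (by simpa using h) (by simpa using hv))
  have hΓu : Γ u = (((Γ u).re : ℝ) : ℂ) := Complex.ext (by simp) (by simp [hu])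
  have hΓv : Γ v = (((Γ v).re : ℝ) : ℂ) := Complex.ext (by simp) (by simp [hv])
  have eu : (log (I * Γ u)).im = π / 2 * (zsgn (Γ u).re : ℝ) := by
    conv_lhs => rw [hΓu]
    exact im_log_I_mul hreU
  have ev : (log (I * Γ v)).im = π / 2 * (zsgn (Γ v).re : ℝ) := by
    conv_lhs => rw [hΓv]
    exact im_log_I_mul hreV
  have hi := congrArg Complex.im e
  simp only [Complex.sub_im] at hi
  rw [hi, eu, ev]; ring

/-- BAD PIECE: `Im Γ ≥ 0` on `[u, v]`, real non-zero ends ⇒ every continuous logarithm gains `−(π/2)(σ(v) − σ(u))` in imaginary part. -/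
theorem im_incr_piece_up {Γ l : ℝ → ℂ} {u v : ℝ} (huv : u ≤ v) (hΓ : ContinuousOn Γ (Icc u v)) (hl : ContinuousOn l (Icc u v))
    (hexp : ∀ t ∈ Icc u v, exp (l t) = Γ t) (hne : ∀ t ∈ Icc u v, Γ t ≠ 0) (hup : ∀ t ∈ Icc u v, 0 ≤ (Γ t).im)
    (hu : (Γ u).im = 0) (hv : (Γ v).im = 0) :
    (l v).im - (l u).im = -(π / 2) * ((zsgn (Γ v).re : ℝ) - (zsgn (Γ u).re : ℝ)) := by
  have hcut : ∀ t ∈ Icc u v, -I * Γ t ∈ slitPlane := by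
    intro t ht
    rw [mem_slitPlane_iff]
    rcases (hup t ht).lt_or_eq with hlt | heq
    · left
      have e : (-I * Γ t).re = (Γ t).im := by simp [Complex.mul_re]
      rw [e]; exact hlt
    · right
      have hre : (Γ t).re ≠ 0 := fun h => hne t ht (Complex.ext (by simpa using h) (by simpa using heq.symm))
      simpa [Complex.mul_im] using hre
  have e := log_increment_eq huv hΓ hl hexp (neg_ne_zero.2 I_ne_zero) hcut
  have hreU : (Γ u).re ≠ 0 := fun h => hne u (left_mem_Icc.2 huv) (Complex.ext (by simpa using h) (by simpa using hu))
  have hreV : (Γ v).re ≠ 0 := fun h => hne v (right_mem_Icc.2 huv) (Complex.ext (by simpa using h) (by simpa using hv))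
  have hΓu : Γ u = (((Γ u).re : ℝ) : ℂ) := Complex.ext (by simp) (by simp [hu])
  have hΓv : Γ v = (((Γ v).re : ℝ) : ℂ) := Complex.ext (by simp) (by simp [hv])
  have eu : (log (-I * Γ u)).im = -(π / 2) * (zsgn (Γ u).re : ℝ) := by
    conv_lhs => rw [hΓu]
    exact im_log_negI_mul hreU
  have ev : (log (-I * Γ v)).im = -(π / 2) * (zsgn (Γ v).re : ℝ) := by
    conv_lhs => rw [hΓv]
    exact im_log_negI_mul hreV
  have hi := congrArg Complex.im e
  simp only [Complex.sub_im] at hi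
  rw [hi, eu, ev]; ring

/-! ## §3 The potential argument along the finitely many real points -/

/-- A continuous real function without zeros on an open interval has constant sign there. -/
theorem pos_or_neg_of_ne_zero {g : ℝ → ℝ} {a b : ℝ} (hg : ContinuousOn g (Icc a b)) (hne : ∀ s ∈ Ioo a b, g s ≠ 0) :
    (∀ s ∈ Ioo a b, 0 < g s) ∨ (∀ s ∈ Ioo a b, g s < 0) := by
  by_contra h
  rw [not_or] at h
  obtain ⟨h1, h2⟩ := h
  push Not at h1 h2
  obtain ⟨s₁, hs₁, hle₁⟩ := h1
  obtain ⟨s₂, hs₂, hle₂⟩ := h2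
  have hlt₁ : g s₁ < 0 := lt_of_le_of_ne hle₁ (hne s₁ hs₁)
  have hlt₂ : 0 < g s₂ := lt_of_le_of_ne hle₂ (hne s₂ hs₂).symm
  rcases le_total s₁ s₂ with hle | hle
  · obtain ⟨s, hs, hs0⟩ := intermediate_value_Icc hle (hg.mono (Icc_subset_Icc hs₁.1.le hs₂.2.le)) ⟨hlt₁.le, hlt₂.le⟩
    exact hne s ⟨lt_of_lt_of_le hs₁.1 hs.1, lt_of_le_of_lt hs.2 hs₂.2⟩ hs0
  · obtain ⟨s, hs, hs0⟩ := intermediate_value_Icc' hle (hg.mono (Icc_subset_Icc hs₂.1.le hs₁.2.le)) ⟨hlt₁.le, hlt₂.le⟩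
    exact hne s ⟨lt_of_lt_of_le hs₂.1 hs.1, lt_of_le_of_lt hs.2 hs₁.2⟩ hs0

/-- ★ POTENTIAL MONOTONICITY (the partition form of `two_mul_wind_eq`, as an inequality).  `Γ` continuous and zero-free on `[0, ½]` with real
ends and finitely many real points, `l` a continuous logarithm; if no BAD piece (`Im Γ > 0` inside, real ends) is ASCENDING (`Re Γ` from negative
to positive) then `Im (l(½) − l(0)) ≥ (π/2)(σ(½) − σ(0))`. -/
theorem im_incr_ge_of_noAsc {Γ l : ℝ → ℂ} (hΓ : ContinuousOn Γ (Icc 0 (1 / 2))) (hl : ContinuousOn l (Icc 0 (1 / 2)))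
    (hexp : ∀ t ∈ Icc (0 : ℝ) (1 / 2), exp (l t) = Γ t) (hne : ∀ t ∈ Icc (0 : ℝ) (1 / 2), Γ t ≠ 0)
    (h0 : (Γ 0).im = 0) (hh : (Γ (1 / 2)).im = 0) (hfin : {t : ℝ | t ∈ Icc (0 : ℝ) (1 / 2) ∧ (Γ t).im = 0}.Finite)
    (hna : ∀ t₁ t₂ : ℝ, 0 ≤ t₁ → t₁ < t₂ → t₂ ≤ 1 / 2 → (∀ t ∈ Ioo t₁ t₂, 0 < (Γ t).im) → (Γ t₁).im = 0 → (Γ t₂).im = 0 →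
      ¬ ((Γ t₁).re < 0 ∧ 0 < (Γ t₂).re)) :
    π / 2 * ((zsgn (Γ (1 / 2)).re : ℝ) - (zsgn (Γ 0).re : ℝ)) ≤ (l (1 / 2)).im - (l 0).im := by
  classical
  set Z : Finset ℝ := hfin.toFinset with hZ
  have hmemZ : ∀ t, t ∈ Z ↔ t ∈ Icc (0 : ℝ) (1 / 2) ∧ (Γ t).im = 0 := fun t => by
    rw [hZ, Set.Finite.mem_toFinset]; rfl
  have hhalf : (1 / 2 : ℝ) ∈ Z := (hmemZ _).2 ⟨⟨by norm_num, le_rfl⟩, hh⟩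
  have hzero : (0 : ℝ) ∈ Z := (hmemZ _).2 ⟨⟨le_rfl, by norm_num⟩, h0⟩
  suffices H : ∀ n : ℕ, ∀ t ∈ Z, (Z.filter (fun s => t < s)).card = n →
      π / 2 * ((zsgn (Γ (1 / 2)).re : ℝ) - (zsgn (Γ t).re : ℝ)) ≤ (l (1 / 2)).im - (l t).im from H _ 0 hzero rfl
  intro n
  induction n using Nat.strong_induction_on with
  | _ n ih =>
  intro t ht hcard
  obtain ⟨⟨ht0, hth⟩, htim⟩ := (hmemZ t).1 ht
  rcases hth.eq_or_lt with rfl | hlt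
  · simp
  have hne' : (Z.filter (fun s => t < s)).Nonempty := ⟨1 / 2, Finset.mem_filter.2 ⟨hhalf, hlt⟩⟩
  obtain ⟨ht'Z, htt'⟩ := Finset.mem_filter.1 (Finset.min'_mem _ hne')
  set t' : ℝ := (Z.filter (fun s => t < s)).min' hne' with ht'
  obtain ⟨⟨-, ht'h⟩, ht'im⟩ := (hmemZ t').1 ht'Z
  have hmin : ∀ s ∈ Z, t < s → t' ≤ s := fun s hs hts => Finset.min'_le _ _ (Finset.mem_filter.2 ⟨hs, hts⟩)
  have hsub : Icc t t' ⊆ Icc (0 : ℝ) (1 / 2) := Icc_subset_Icc ht0 ht'h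
  have hgap : ∀ s ∈ Ioo t t', (Γ s).im ≠ 0 := by
    intro s hs h0s
    have hsZ : s ∈ Z := (hmemZ s).2 ⟨⟨ht0.trans hs.1.le, hs.2.le.trans ht'h⟩, h0s⟩
    exact absurd (hmin s hsZ hs.1) (not_le.2 hs.2)
  have hcard' : (Z.filter (fun s => t' < s)).card < n := by
    rw [← hcard]
    refine Finset.card_lt_card ⟨fun s hs => ?_, fun hss => ?_⟩
    · obtain ⟨hsZ, hs⟩ := Finset.mem_filter.1 hs
      exact Finset.mem_filter.2 ⟨hsZ, htt'.trans hs⟩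
    · exact lt_irrefl _ (Finset.mem_filter.1 (hss (Finset.min'_mem _ hne'))).2
  have IH := ih _ hcard' t' ht'Z rfl
  have hret : (Γ t).re ≠ 0 := fun h => hne t ⟨ht0, hth⟩ (Complex.ext (by simpa using h) (by simpa using htim))
  have hcont : ContinuousOn (fun s => (Γ s).im) (Icc t t') := Complex.continuous_im.comp_continuousOn (hΓ.mono hsub)
  have hpiece : π / 2 * ((zsgn (Γ t').re : ℝ) - (zsgn (Γ t).re : ℝ)) ≤ (l t').im - (l t).im := by
    rcases pos_or_neg_of_ne_zero hcont hgap with hpos | hneg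
    · -- a BAD piece: not ascending
      have hup : ∀ s ∈ Icc t t', 0 ≤ (Γ s).im := by
        intro s hs
        rcases hs.1.eq_or_lt with h1 | h1
        · rw [← h1, htim]
        · rcases hs.2.lt_or_eq with h2 | h2
          · exact (hpos s ⟨h1, h2⟩).le
          · rw [h2, ht'im]
      have e := im_incr_piece_up htt'.le (hΓ.mono hsub) (hl.mono hsub) (fun s hs => hexp s (hsub hs))
        (fun s hs => hne s (hsub hs)) hup htim ht'im
      have hn := hna t t' ht0 htt' ht'h hpos htim ht'im
      have hσ : ((zsgn (Γ t').re : ℝ) - (zsgn (Γ t).re : ℝ)) ≤ 0 := by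
        unfold zsgn
        by_cases h1 : 0 < (Γ t').re
        · by_cases h2 : 0 < (Γ t).re
          · rw [if_pos h1, if_pos h2]; push_cast; linarith
          · exact absurd ⟨lt_of_le_of_ne (not_lt.1 h2) hret, h1⟩ hn
        · rw [if_neg h1]
          split_ifs <;> push_cast <;> linarith
      rw [e]; nlinarith [Real.pi_pos]
    · -- a GOOD piece
      have hdown : ∀ s ∈ Icc t t', (Γ s).im ≤ 0 := by
        intro s hs
        rcases hs.1.eq_or_lt with h1 | h1
        · rw [← h1, htim]
        · rcases hs.2.lt_or_eq with h2 | h2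
          · exact (hneg s ⟨h1, h2⟩).le
          · rw [h2, ht'im]
      have e := im_incr_piece_down htt'.le (hΓ.mono hsub) (hl.mono hsub) (fun s hs => hexp s (hsub hs))
        (fun s hs => hne s (hsub hs)) hdown htim ht'im
      rw [e]
  linarith [hpiece, IH]

/-! ## §4 The loop inequality -/

/-- ★ LOOP INEQUALITY (partition form of `two_mul_wind_eq`).  A conjugation-symmetric (`Γ(1 − t) = conj Γ(t)`) zero-free loop whose upper half
`[0, ½]` has finitely many real points — or is real throughout — and no ascending bad piece satisfies `2·wind Γ = sgn Re Γ(½) − sgn Re Γ(0) + n`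
with `n ∈ ℕ`. -/
theorem two_mul_wind_ge {Γ : ℝ → ℂ} (hΓ : ContinuousOn Γ (Icc 0 1)) (h01 : Γ 0 = Γ 1) (hne : ∀ t ∈ Icc (0 : ℝ) 1, Γ t ≠ 0)
    (hsym : ∀ t ∈ Icc (0 : ℝ) 1, Γ (1 - t) = (starRingEnd ℂ) (Γ t))
    (hZ : {t : ℝ | t ∈ Icc (0 : ℝ) (1 / 2) ∧ (Γ t).im = 0}.Finite ∨ ∀ t ∈ Icc (0 : ℝ) (1 / 2), (Γ t).im = 0)
    (hna : ∀ t₁ t₂ : ℝ, 0 ≤ t₁ → t₁ < t₂ → t₂ ≤ 1 / 2 → (∀ t ∈ Ioo t₁ t₂, 0 < (Γ t).im) → (Γ t₁).im = 0 → (Γ t₂).im = 0 →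
      ¬ ((Γ t₁).re < 0 ∧ 0 < (Γ t₂).re)) :
    ∃ n : ℕ, 2 * (wind Γ : ℂ) = sgn (Γ (1 / 2)).re - sgn (Γ 0).re + n := by
  obtain ⟨l, hl, hle⟩ := (IsNonvanishingLoop.mk hΓ hne h01).hasLogOn
  have hw := wind_spec hl hle h01
  have hq0 : (0 : ℝ) ≤ 1 / 2 := by norm_num
  have hq1 : (1 / 2 : ℝ) ≤ 1 := by norm_num
  have h0 : (Γ 0).im = 0 := by
    have e := hsym 0 ⟨le_rfl, zero_le_one⟩
    rw [sub_zero, ← h01] at e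
    exact conj_eq_iff_im.1 e.symm
  have hh : (Γ (1 / 2)).im = 0 := by
    have e := hsym (1 / 2) ⟨hq0, hq1⟩
    rw [show (1 : ℝ) - 1 / 2 = 1 / 2 by norm_num] at e
    exact conj_eq_iff_im.1 e.symm
  -- symmetry of the logarithm: `conj l(1 − t)` is another logarithm of `Γ`
  have hI : ∀ t ∈ Icc (0 : ℝ) 1, 1 - t ∈ Icc (0 : ℝ) 1 := fun t ht => ⟨by linarith [ht.2], by linarith [ht.1]⟩
  have hl₂ : ContinuousOn (fun t => (starRingEnd ℂ) (l (1 - t))) (Icc 0 1) := by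
    refine Complex.continuous_conj.comp_continuousOn (hl.comp (continuousOn_const.sub continuousOn_id) fun t ht => hI t ht)
  have hle₂ : ∀ t ∈ Icc (0 : ℝ) 1, exp ((starRingEnd ℂ) (l (1 - t))) = exp (l t) := by
    intro t ht
    rw [Complex.exp_conj, hle (1 - t) (hI t ht), hsym t ht, Complex.conj_conj, hle t ht]
  obtain ⟨k, hk⟩ := exists_int_eq_add_of_exp_eq isPreconnected_Icc hl₂ hl hle₂
  have hk0 := congrArg Complex.im (hk 0 ⟨le_rfl, zero_le_one⟩)
  have hkh := congrArg Complex.im (hk (1 / 2) ⟨hq0, hq1⟩)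
  simp only [sub_zero, Complex.conj_im, Complex.add_im, show (1 : ℝ) - 1 / 2 = 1 / 2 by norm_num] at hk0 hkh
  have hkI : ((k : ℂ) * (2 * π * I)).im = 2 * π * k := by simp [Complex.mul_im]; ring
  rw [hkI] at hk0 hkh
  have hsymL : (l 1).im - (l (1 / 2)).im = (l (1 / 2)).im - (l 0).im := by linarith
  -- the upper half: the potential inequality (finite case) or one flat piece
  have hhalf : π / 2 * ((zsgn (Γ (1 / 2)).re : ℝ) - (zsgn (Γ 0).re : ℝ)) ≤ (l (1 / 2)).im - (l 0).im := by
    have hΓ' := hΓ.mono (Icc_subset_Icc_right hq1)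
    have hl' := hl.mono (Icc_subset_Icc_right hq1)
    have hle' : ∀ t ∈ Icc (0 : ℝ) (1 / 2), exp (l t) = Γ t := fun t ht => hle t ⟨ht.1, ht.2.trans hq1⟩
    have hne' : ∀ t ∈ Icc (0 : ℝ) (1 / 2), Γ t ≠ 0 := fun t ht => hne t ⟨ht.1, ht.2.trans hq1⟩
    rcases hZ with hfin | hflat
    · exact im_incr_ge_of_noAsc hΓ' hl' hle' hne' h0 hh hfin hna
    · exact (im_incr_piece_down hq0 hΓ' hl' hle' hne' (fun t ht => (hflat t ht).le) h0 hh).symm.le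
  -- the winding number
  have hwim := congrArg Complex.im hw
  have hwI : ((wind Γ : ℂ) * (2 * π * I)).im = 2 * π * (wind Γ : ℝ) := by simp [Complex.mul_im]; ring
  rw [Complex.sub_im, hwI] at hwim
  have hineq : ((zsgn (Γ (1 / 2)).re : ℝ) - (zsgn (Γ 0).re : ℝ)) ≤ 2 * (wind Γ : ℝ) := by nlinarith [Real.pi_pos]
  have hint : (0 : ℤ) ≤ 2 * wind Γ - (zsgn (Γ (1 / 2)).re - zsgn (Γ 0).re) := by
    have h : (0 : ℝ) ≤ ((2 * wind Γ - (zsgn (Γ (1 / 2)).re - zsgn (Γ 0).re) : ℤ) : ℝ) := by push_cast; linarith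
    exact_mod_cast h
  obtain ⟨n, hn⟩ := Int.eq_ofNat_of_zero_le hint
  refine ⟨n, ?_⟩
  rw [sgn_eq_zsgn, sgn_eq_zsgn]
  have hn' : ((2 * wind Γ - (zsgn (Γ (1 / 2)).re - zsgn (Γ 0).re) : ℤ) : ℂ) = ((n : ℤ) : ℂ) := by rw [hn]
  push_cast at hn'
  linear_combination hn'

/-! ## §5 Finiteness of the real points of `(G′/G) ∘ circleLoop` -/

/-- Conjugation symmetry of a circle loop with real centre: `circleLoop c r (1 − t) = conj (circleLoop c r t)`. -/
theorem circleLoop_one_sub (c r t : ℝ) : circleLoop (c : ℂ) r (1 - t) = (starRingEnd ℂ) (circleLoop (c : ℂ) r t) := by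
  rw [circleLoop_apply, circleLoop_apply, map_add, Complex.conj_ofReal, map_mul, Complex.conj_ofReal, ← Complex.exp_conj]
  congr 2
  have e1 : (2 * (π : ℂ) * ((1 - t : ℝ) : ℂ) * I) = 2 * π * I + -(2 * π * t * I) := by push_cast; ring
  rw [e1, Complex.exp_add, Complex.exp_two_pi_mul_I, one_mul, map_mul, map_mul, map_mul, Complex.conj_I, Complex.conj_ofReal,
    Complex.conj_ofReal, map_ofNat]
  congr 1; ring

/-- `t ↦ Im ((G′/G)(circleLoop c r t))` is real-analytic at every `t` when `G` is entire and zero-free on the circle. -/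
theorem analyticAt_im_logDeriv_circleLoop {G : ℂ → ℂ} (hG : Differentiable ℂ G) {c r : ℝ}
    (hG0 : ∀ t : ℝ, G (circleLoop (c : ℂ) r t) ≠ 0) (t : ℝ) :
    AnalyticAt ℝ (fun s : ℝ => (deriv G (circleLoop (c : ℂ) r s) / G (circleLoop (c : ℂ) r s)).im) t := by
  have hF : Differentiable ℂ fun z : ℂ => (c : ℂ) + r * exp (2 * π * z * I) := by fun_prop
  have hγ : AnalyticAt ℝ (fun s : ℝ => circleLoop (c : ℂ) r s) t := by
    have h1 : AnalyticAt ℝ (fun z : ℂ => (c : ℂ) + r * exp (2 * π * z * I)) (Complex.ofRealCLM t) :=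
      (hF.analyticAt _).restrictScalars
    have h2 := h1.comp (Complex.ofRealCLM.analyticAt t)
    refine h2.congr (Eventually.of_forall fun s => ?_)
    simp [Function.comp, circleLoop_apply]
  have hφ : AnalyticAt ℂ (fun w : ℂ => deriv G w / G w) (circleLoop (c : ℂ) r t) :=
    (hG.deriv.analyticAt _).div (hG.analyticAt _) (hG0 t)
  have h3 : AnalyticAt ℝ (fun s : ℝ => deriv G (circleLoop (c : ℂ) r s) / G (circleLoop (c : ℂ) r s)) t :=
    hφ.restrictScalars.comp hγ
  exact (Complex.imCLM.analyticAt _).comp h3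

/-- ★ FINITELY MANY REAL POINTS, OR ALL REAL: for `G` entire and zero-free on the circle, the set of `t ∈ [0, ½]` at which `(G′/G)(circleLoop c r t)`
is real is finite, unless it is all of `[0, ½]` (identity theorem for the real-analytic function `Im (G′/G) ∘ circleLoop`). -/
theorem breaks_finite_or_flat {G : ℂ → ℂ} (hG : Differentiable ℂ G) {c r : ℝ} (hG0 : ∀ t : ℝ, G (circleLoop (c : ℂ) r t) ≠ 0) :
    {t : ℝ | t ∈ Icc (0 : ℝ) (1 / 2) ∧ (deriv G (circleLoop (c : ℂ) r t) / G (circleLoop (c : ℂ) r t)).im = 0}.Finite ∨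
      ∀ t ∈ Icc (0 : ℝ) (1 / 2), (deriv G (circleLoop (c : ℂ) r t) / G (circleLoop (c : ℂ) r t)).im = 0 := by
  set h : ℝ → ℝ := fun s => (deriv G (circleLoop (c : ℂ) r s) / G (circleLoop (c : ℂ) r s)).im with hh
  have han : AnalyticOnNhd ℝ h univ := fun t _ => analyticAt_im_logDeriv_circleLoop hG hG0 t
  by_cases hfin : {t : ℝ | t ∈ Icc (0 : ℝ) (1 / 2) ∧ h t = 0}.Finite
  · exact Or.inl hfin
  right
  obtain ⟨z₀, -, hacc⟩ := Set.Infinite.exists_accPt_of_subset_isCompact hfin isCompact_Icc (fun t ht => ht.1)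
  have hfreq : ∃ᶠ s in 𝓝[≠] z₀, h s = 0 := (accPt_iff_frequently_nhdsNE.1 hacc).mono fun s hs => hs.2
  have hzero := han.eqOn_zero_of_preconnected_of_frequently_eq_zero isPreconnected_univ (mem_univ z₀) hfreq
  intro t _
  exact hzero (mem_univ t)

end RhW08.Lens1ArcSign
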